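import Literature.MathematicalPhysics.QuantumFieldTheory.Balaban1983to89.B9Thm33GKernelDecayCubeMemberZd
import Literature.MathematicalPhysics.QuantumFieldTheory.Balaban1983to89.B9Eq326LocalLettersBumpBoundsZd
import Literature.MathematicalPhysics.QuantumFieldTheory.Balaban1983to89.B9Thm311PerMemberCubeZdTouching
import Literature.MathematicalPhysics.QuantumFieldTheory.Balaban1983to89.B9Eq334GaugeCovarianceZdHerm

/-!
# `Balaban1983to89.B9Thm311KernelDecayTouchingCubeZd` — [Balaban1985BackgroundPropagators] Thm 3.11 p. 416 «the kernels (Q′G′²Q′*)⁻¹(y,y′), G(x,x′) decay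
# exponentially» with Thm 3.3 p. 399, AT ONE CUBE MEMBER OF [Balaban1985RegularSpaces] (1.131), IN THE DATUM'S CURRENCY: there are `α, C, κ > 0` (member-dependent)
# such that EVERY unitary background `U₀` whose plaquettes TOUCHING `□₀` are `α`-close to `1` (the level-`0` clause of (1.7), p. 77) — in particular every
# `U₀ ∈ 𝔄_m({□_j}, α₀)`, `α₀ ≤ α` — has `|(G_𝔤(U₀)δ_{b′}w)(b)|_τ ≤ C·e^{−κ|b−b′|_∞}·|w|_τ` on the bonds of `□₀` (Hermitian `w`) for the genuine four-letter record
# `opsAllZd τ L (cubeLamBP …) ops₀ M i m`; obtained from dag-n06-w2's GLOBAL-class theorem `B9Thm33GKernelDecayCubeMemberZd` (Combes–Thomas stations 1–5) with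
# its three displayed local-letter bounds DISCHARGED by this seat's `B9Eq326LocalLettersBumpBoundsZd`, moved to the touching class by the layer-gauge schema
# (B)(G)(L) of `B9Thm311PerMemberCubeZdTouching`

statement-level skeleton of published theorems with citation tags; proofs where landed; nothing here is a claim about the
Yang–Mills mass gap

`[Balaban1985BackgroundPropagators]` ("B9", CMP **99** (1985) 389–434): Thm 3.11 p. 416 (positivity, uniform lower bounds and exponential decay of the kernels
of `Δ_a`, `G` «under the assumptions of the Theorems 3.1–3.10», proved by «doing the gauge transformation … U = e^{iηA} with A small»), Thm 3.3 p. 399, (3.27)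
p. 395 (`G(U) = (Ω₀Δ_aΩ₀)⁻¹`), (3.28)∕(3.34) pp. 395–396 (gauge covariance); [Balaban1985RegularSpaces] (1.7) p. 77 (the class `𝔄_k({Ω_j}, α₀)` with the
TOUCHING convention «we denote by Ω also the set of bonds … similarly for … plaquettes»), Lemma 1 p. 79, (1.131) p. 99.  HERE: by-name composition; the
decay RATE and CONSTANT are existential and member-dependent (compactness, crude letter sizes) — NOT print's uniform `δ₀(d, L)`, `B₀`.

CITATION HEADER (lean-in-tree rule).  Cell `pub-ymgap` (YM Track A, HUMAN RULING D-0062 ∕ D-0149), DAG node N06 = [B9], seat `pub-ymgap-dag-n06-b` (g21;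
junction ∕ letter lineage), CLAIM-2 (pre-announced INBOX l.37061, sequenced after dag-n06-w2 g4's CLAIM-14).  Inputs BY NAME: dag-n06-w2's
`B9Thm33GKernelDecayCubeMemberZd.exists_fnorm_gopZdH_bump_le_exp_cubeMember_of_letters` (the (B) input on the global class); this seat's
`B9Eq326LocalLettersBumpBoundsZd.exists_letterBounds_opsAllZd_cube` (the three local-letter bounds), `B9Thm311PerMemberCubeZdTouching.{of_touching_plaquettes_unitary,
sqLo_le_sqHi_zero, plaq_le_of_inAk}` (the schema), `B9Eq326DeltaALocalityZdSides.deltaAOf_opsAllZd_congr_sides` + `B9Eq326DeltaALocalityZd.{deltaADom_congr_of_bonds,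
regularAtH_congr_of_deltaADom}` + `B9Eq316AveragingTransposeZdLevelZero.hbox0_cubeLamBP_of_eq` (the (L) input), `B9Eq327GreenZdHerm.{gopZdH, deltaAEquivH, restrictLinH, …}`;
dag-n06-w3's `B9Eq334GaugeCovarianceZdHerm.gopZdH_opsAllZd_gaugeAct` + `B9Eq334GaugeCovarianceZd.rotB` + `B9Eq333ProjectionCovarianceZd.isSelfAdjoint_conjR` (the (G) input);
dag-n06-w2's `B9Eq342CombesThomasFormZd.fnorm`, `B9Thm31GpDecayOfCoerciveZd.fnorm_conjR_of_unitary`, `B9Eq17RegimeBallZd.norm_plaqF_sub_one_le`; dag-n06-w4's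
`B9Thm311PosDefOpenZd.cubeMember_Ω0_finite`.  Nothing restated.

WHAT IS PROVED (kernel, 0 sorry, 0 def).
* §0 `exists_Ctau` — on a finite-dimensional fibre every linear `τ` is bounded: `∃ C_τ ≥ 0, |Re τ(x*y)| ≤ C_τ‖x‖‖y‖` (discharges the `hCτ` of the letter files).
* §1 (L): ★ `gopZdH_congr_of_deltaADom` (any record: backgrounds whose `Δ_a↾Ω₀` agree on `E_𝔤(Ω₀)` have the same `G_𝔤`), ★ `deltaAOf_opsAllZd_congr_cube_sides` (the
  pointwise key at a cube member: `Δ_a(U₀)A(b) = Δ_a(U₀′)A(b)` at the bonds of `□₀` for backgrounds agreeing on the sides of the plaquettes touching `□₀`),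
  ★★ `gopZdH_opsAllZd_congr_cube_sides` (`G_𝔤(U₀)J = G_𝔤(U₀′)J` then).
* §2 (G): `bump_eq_rotB_bump` (`δ_{b′}w = R(u)δ_{b′}(R(u(b′))⁻¹w)`), ★★ `kernelDecay_opsAllZd_gaugeAct` (the kernel bound with constants `(C, κ)` passes from `U₀` to
  `U₀^u`, `u` unitary, `τ` tracial — (3.34)).
* §3 the schema: ★★★ `kernelDecay_of_plaqTouches_cube_of_ball` (the bound on a uniform ball of unitary backgrounds ⟹ `∃ α > 0`, the bound, SAME `(C, κ)`, at every
  unitary `U₀` whose plaquettes touching `□₀` are `α`-close to `1`), ★★ `kernelDecay_of_inAk_cube_of_ball` (⟹ for every `U₀ ∈ 𝔄_m({□_j}, α₀)`, `α₀ ≤ α`).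
* §4 the (B) input made unconditional: ★★★ `exists_kernelDecay_cubeMember` — dag-n06-w2's global-class theorem with `hLet` discharged by
  `exists_letterBounds_opsAllZd_cube` and `hCτ` by `exists_Ctau`: for `2 ≤ d`, `2 ≤ L ≤ ρ`, `m ≤ k`, weights `a ≥ 0`, faithful Hermitian tracial `τ`:
  `∃ β₀ > 0 ∀ 0 ≤ β < β₀ ∃ C κ > 0 ∀ unitary U₀` with `‖U₀(∂p) − 1‖ ≤ β` EVERYWHERE: the kernel bound on the bonds of `□₀`.
* §5 ★★★★ `exists_kernelDecay_of_plaqTouches_cube` — THE DECAY CLAUSE OF THEOREM 3.11 AT THE MEMBER IN THE TOUCHING CURRENCY: `∃ α C κ > 0 ∀ unitary U₀` with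
  `‖U₀(∂p) − 1‖ ≤ α` for the plaquettes TOUCHING `□₀`: `|(G_𝔤(U₀)δ_{b′}w)(b)|_τ ≤ C·e^{−κ|b−b′|_∞}·|w|_τ` (bonds of `□₀`, Hermitian `w`) — NO displayed hypothesis;
  ★★★★ `exists_kernelDecay_of_inAk_cube` — the same for every datum `U₀ ∈ 𝔄_m({□_j}, α₀)`, `α₀ ≤ α` (the socket's own hypothesis [Balaban1985RegularSpaces] (1.33)).

HONEST SCOPE.  Count-neutral helper; `α, C, κ` EXISTENTIAL and MEMBER-DEPENDENT (through `η = i.η`, `m`, the cube data, compactness constants and crude letter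
sizes) — print's Theorem 3.11 ∕ 3.3 are UNIFORM in the class with constants depending on `d, L` only: NOT proved here; no `L^p`∕Hölder members of (3.42)–(3.47);
N05 ∕ N06 NOT discharged; K1⁹ `stmt-QuantumFields-27364` NOT closed; one finite `𝕋⁴` programme at fixed `ε`, Bałaban as printed; R4 closes only the conditional
finite-`𝕋⁴` rung `BalabanLadder.UV` — nothing continuum ∕ ℝ⁴ ∕ OS ∕ mass gap ∕ Clay.  Unit `pub-ymgap-dag-n06-b` (g21), 2026-08-28.
-/

noncomputable section

open scoped BigOperators

namespace Literature.MathematicalPhysics.QuantumFieldTheory.Balaban1983to89.B9Thm311KernelDecayTouchingCubeZd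

open B7Prop1Explicit (e gaugeAct U1)
open B7Prop1Local (InBox AgreeOn loK bondHiK)
open B7Prop2Explicit (unitaryUnits unitaryUnits_le_U1)
open B7Prop5Flat (bump)
open B7Eq78Linearization (conjR conjR_apply)
open B8Ineq132 (PlaqTouches BondTouches plaqF InAk)
open B8Eq140Level (SideTouches sideTouches_of_bondTouches)
open B8Eq131Cubes (cube sqLo sqHi cube_anti mem_cube_iff)
open B8Eq131CubesAdmissible (cubeFam cubeFam_false_of_le cubeFam_false_zero)
open B8CubeMemberZd (cubeLamS inBox_sq_of_mem_cubeLamS)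
open B8Ineq159FlatCubeMemberPrinted (cubeLamBP)
open B8LeafModelZd (ZdIdx)
open B9SupplySockB9P3ZdLetters (OpsZd deltaAOf)
open B9Eq327GreenZd (domSub)
open B9Eq327GreenZdHerm (domSubH RegularAtH gopZdH deltaAEquivH deltaAEquivH_coe restrictLinH gopZdH_of_regularAtH gopZdH_of_not_regularAtH)
open B9SupplySockB9P3ZdAllLettersZd (opsAllZd)
open B9Eq321LandauProjectionZd (opsLandau)
open B9SupplySockB9P3ZdGammaInAkDpZd (withDpZd)
open B9Eq316AveragingTransposeZdPrinted (withQQP)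
open B9Eq316AveragingTransposeZdLevelZero (hbox0_cubeLamBP_of_eq)
open B9Eq326DeltaALocalityZd (deltaADom_congr_of_bonds regularAtH_congr_of_deltaADom)
open B9Eq326DeltaALocalityZdSides (deltaAOf_opsAllZd_congr_sides)
open B9Eq334GaugeCovarianceZd (rotB rotB_apply)
open B9Eq334GaugeCovarianceZdHerm (gopZdH_opsAllZd_gaugeAct)
open B9Eq333ProjectionCovarianceZd (isSelfAdjoint_conjR)
open B9Thm311PerMemberCubeZdTouching (of_touching_plaquettes_unitary sqLo_le_sqHi_zero plaqTouches_mono plaq_le_of_inAk)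
open B9Eq342CombesThomasFormZd (fnorm)
open B9Thm31GpDecayOfCoerciveZd (fnorm_conjR_of_unitary)
open B9Eq326LocalLettersBumpBoundsZd (exists_letterBounds_opsAllZd_cube)
open B9Thm33GKernelDecayCubeMemberZd (exists_fnorm_gopZdH_bump_le_exp_cubeMember_of_letters)
open B9Eq17RegimeBallZd (norm_plaqF_sub_one_le)
open Literature.MathematicalPhysics.QuantumLattice (blockBase)
open LatticeNorms (linfDist)

-- `Site` alone could resolve to the torus sites of `Setup.lean`; re-export the `ℤ^d` sites of `B7Prop1Explicit`.
export B7Prop1Explicit (Site)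

variable {d : ℕ} {𝔸 : Type*} [CStarAlgebra 𝔸]

/-! ## §0 The fibre constant `C_τ` is automatic on a finite-dimensional fibre -/

section Fibre

/-- **ON A FINITE-DIMENSIONAL FIBRE EVERY LINEAR `τ` IS BOUNDED**: `∃ C_τ ≥ 0` with `|Re τ(x* y)| ≤ C_τ‖x‖‖y‖` (the `hCτ` hypothesis of the transpose ∕ letter files —
`B9Eq316AveragingTransposeZd.norm_entryT_le`, `B9Eq326LocalLettersBumpBoundsZd` — discharged: `τ` is continuous, `‖x* y‖ ≤ ‖x‖‖y‖`).
[cite: Balaban1985BackgroundPropagators, p.391 («X·Y = tr XY»; bookkeeping)] -/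
theorem exists_Ctau [FiniteDimensional ℝ 𝔸] (τ : 𝔸 →ₗ[ℂ] ℂ) :
    ∃ Cτ : ℝ, 0 ≤ Cτ ∧ ∀ x y : 𝔸, |(τ (star x * y)).re| ≤ Cτ * ‖x‖ * ‖y‖ := by
  let T : 𝔸 →L[ℝ] ℂ := LinearMap.toContinuousLinearMap (τ.restrictScalars ℝ)
  have hT : ∀ a : 𝔸, τ a = T a := fun a => rfl
  refine ⟨‖T‖, norm_nonneg _, fun x y => ?_⟩
  calc |(τ (star x * y)).re| ≤ ‖τ (star x * y)‖ := Complex.abs_re_le_norm _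
    _ = ‖T (star x * y)‖ := by rw [hT]
    _ ≤ ‖T‖ * ‖star x * y‖ := T.le_opNorm _
    _ ≤ ‖T‖ * (‖x‖ * ‖y‖) := by
        refine mul_le_mul_of_nonneg_left ((norm_mul_le _ _).trans ?_) (norm_nonneg _)
        rw [norm_star]
    _ = ‖T‖ * ‖x‖ * ‖y‖ := by ring

end Fibre

/-! ## §1 (L): `G_𝔤(U₀)` reads the background only through `Δ_a↾E_𝔤(Ω₀)` — at a cube member, through the sides of the plaquettes touching `□₀` -/

section Locality

/-- **`G_𝔤` READS `Δ_a↾Ω₀` ON `E_𝔤(Ω₀)` ONLY** (any record): two backgrounds whose restricted operators agree on `E_𝔤(Ω₀)` have the same `G_𝔤` (in the regime by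
uniqueness of the inverse, outside it both are `0`). [cite: Balaban1985BackgroundPropagators, (3.27) p.395, Thm 3.11 p.416] -/
theorem gopZdH_congr_of_deltaADom (η : ℝ) (o : OpsZd d 𝔸) (Ω₀ : Set (Site d)) {U U' : Site d → Fin d → 𝔸ˣ}
    (h : ∀ A ∈ domSubH (𝔸 := 𝔸) Ω₀, B9Eq327GreenZd.deltaADom η o Ω₀ U A = B9Eq327GreenZd.deltaADom η o Ω₀ U' A)
    (J : Site d → Fin d → 𝔸) : gopZdH η o Ω₀ U J = gopZdH η o Ω₀ U' J := by
  by_cases hr : RegularAtH η o Ω₀ U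
  · have hr' : RegularAtH η o Ω₀ U' := (regularAtH_congr_of_deltaADom η o Ω₀ h).1 hr
    rw [gopZdH_of_regularAtH η o Ω₀ _ hr, gopZdH_of_regularAtH η o Ω₀ _ hr']
    congr 1
    rw [LinearEquiv.symm_apply_eq]
    apply Subtype.ext
    rw [deltaAEquivH_coe, h _ ((deltaAEquivH η o Ω₀ U' hr').symm (restrictLinH Ω₀ J)).2, ← deltaAEquivH_coe η o Ω₀ U' hr',
      LinearEquiv.apply_symm_apply]
  · have hr' : ¬ RegularAtH η o Ω₀ U' := fun h1 => hr ((regularAtH_congr_of_deltaADom η o Ω₀ h).2 h1)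
    rw [gopZdH_of_not_regularAtH η o Ω₀ _ hr, gopZdH_of_not_regularAtH η o Ω₀ _ hr']

omit [CStarAlgebra 𝔸] in
/-- in dimension `d ≥ 2` every direction has a second one. [folklore] -/
private theorem exists_ne_dir₂ (hd2 : 2 ≤ d) (μ : Fin d) : ∃ κ : Fin d, κ ≠ μ := by
  by_cases h : (μ : ℕ) = 0
  · exact ⟨⟨1, by omega⟩, fun e => by have := congrArg Fin.val e; simp [h] at this⟩
  · exact ⟨⟨0, by omega⟩, fun e => by have := congrArg Fin.val e; simp at this; omega⟩

omit [CStarAlgebra 𝔸] in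
/-- agreement on the sides of the plaquettes touching `Ω₀` gives agreement on every box whose sites lie in `Ω₀` (`d ≥ 2`).
[cite: Balaban1985RegularSpaces, p.77 (touching convention)] -/
private theorem agreeOn_of_sides {G : Type*} (hd2 : 2 ≤ d) {Ω₀ : Set (Site d)} {U U' : Site d → Fin d → G}
    (hside : ∀ (y : Site d) (τ' : Fin d), SideTouches Ω₀ y τ' → U y τ' = U' y τ') {lo hi : Site d}
    (hin : ∀ x, InBox lo hi x → x ∈ Ω₀) : AgreeOn lo hi U U' := fun x κ hx _ => by
  obtain ⟨κ', hκ'⟩ := exists_ne_dir₂ hd2 κ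
  exact hside x κ (sideTouches_of_bondTouches hκ' (Or.inl (hin x hx)))

/-- the fine block under a level-`j` site of `□_j^{(j)}` lies in `□₀`. [cite: Balaban1985RegularSpaces, (1.131) p.99, p.98] -/
private theorem block_corner_mem_cube_zero {L : ℕ} (hL : 1 ≤ L) (a : Site d) (Mc ρ : ℕ) {k j : ℕ} (hj : j ≤ k) {y : Site d}
    (hy : InBox (sqLo L a ρ k j) (sqHi L a Mc ρ k j) y) {z : Site d} (hz : B8Ineq132.Under L j y z) : z ∈ cube L a Mc ρ k 0 :=
  cube_anti (Nat.zero_le j) hj ((mem_cube_iff hL).2 ⟨y, hy, hz⟩)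

variable (τ : 𝔸 →ₗ[ℂ] ℂ) [FiniteDimensional ℝ 𝔸] {L : ℕ}

/-- ★ **THE KEY AT A CUBE MEMBER**: `Δ_a(U₀)A(b) = Δ_a(U₀′)A(b)` at every bond `b` touching `□₀`, every `A`, for backgrounds agreeing on the sides of the plaquettes touching
`□₀` (`Ω = cubeFam false …`, `Λs = cubeLamS …`, class `cubeLamBP`, `m ≤ k`, `2 ≤ d`, `2 ≤ L ≤ ρ`) — the pointwise form behind `regular_opsAllZd_congr_cube_sides`.
[cite: Balaban1985BackgroundPropagators, (3.26) p.395; Balaban1985RegularSpaces, (1.131) p.99, p.77] -/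
theorem deltaAOf_opsAllZd_congr_cube_sides (hd2 : 2 ≤ d) (hL : 2 ≤ L) (ops₀ : ℝ → ZdIdx d L → ℕ → OpsZd d 𝔸) (M : ℝ) (i : ZdIdx d L)
    {a : Site d} {Mc ρ : ℕ} (hρ : L ≤ ρ) (hΩ : i.Ω = cubeFam false L a Mc ρ i.k) (hΛs : i.Λs = cubeLamS L a Mc ρ i.k)
    (hfin : (i.Ω 0).Finite) {m : ℕ} (hm : m ≤ i.k) {U₀ U₀' : Site d → Fin d → 𝔸ˣ}
    (hside : ∀ (y : Site d) (τ' : Fin d), SideTouches (i.Ω 0) y τ' → U₀ y τ' = U₀' y τ')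
    (A : Site d → Fin d → 𝔸) {x : Site d} {μ : Fin d} (hb : BondTouches (i.Ω 0) x μ) :
    deltaAOf i.η (opsAllZd τ L (cubeLamBP L a Mc ρ i.k) ops₀ M i m) U₀ A x μ =
      deltaAOf i.η (opsAllZd τ L (cubeLamBP L a Mc ρ i.k) ops₀ M i m) U₀' A x μ := by
  have hL1 : 1 ≤ L := le_trans (by norm_num) hL
  have hcube0 : ∀ {x : Site d}, x ∈ cube L a Mc ρ i.k 0 → x ∈ i.Ω 0 := fun {x} hx => by
    rw [hΩ, cubeFam_false_zero]; exact hx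
  refine deltaAOf_opsAllZd_congr_sides τ hd2 hL1 _ ops₀ M i m hfin A hb hside (fun j hj y hy => ?_) (fun j hj1 hj c hc => ?_)
  · rw [hΛs] at hy
    have hyb := inBox_sq_of_mem_cubeLamS hy
    have hjk : j ≤ i.k := hj.trans hm
    have hcorner : ∀ z : Site d, B8Ineq132.Under L j y z → z ∈ i.Ω 0 := fun z hz => hcube0 (block_corner_mem_cube_zero hL1 a Mc ρ hjk hyb hz)
    refine agreeOn_of_sides hd2 hside fun x hx => hcorner x fun i' => ?_
    have h1 := (hx i').1; have h2 := (hx i').2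
    simp only [blockBase, Pi.add_apply, Pi.smul_apply, Pi.one_apply, smul_eq_mul, mul_one] at h1 h2
    push_cast at h1 h2
    constructor <;> nlinarith
  · have hsub := hbox0_cubeLamBP_of_eq hL1 i a Mc hρ hΩ hm j hj1 hj c hc
    have hjk : j - 1 ≤ i.k := by omega
    refine agreeOn_of_sides hd2 hside fun x hx => ?_
    have h := hsub x hx
    rw [hΩ, cubeFam_false_of_le L a Mc ρ hjk] at h
    exact hcube0 (cube_anti (Nat.zero_le _) hjk h)

/-- ★★ **(L) FOR `G_𝔤`: AT A CUBE MEMBER `G_𝔤(U₀)` READS `U₀` ON THE SIDES OF THE PLAQUETTES TOUCHING `□₀` ONLY** — every value `(G_𝔤(U₀)J)(b)`, every `J`.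
[cite: Balaban1985BackgroundPropagators, (3.27) p.395, Thm 3.11 p.416; Balaban1985RegularSpaces, (1.131) p.99, p.77] -/
theorem gopZdH_opsAllZd_congr_cube_sides (hd2 : 2 ≤ d) (hL : 2 ≤ L) (ops₀ : ℝ → ZdIdx d L → ℕ → OpsZd d 𝔸) (M : ℝ) (i : ZdIdx d L)
    {a : Site d} {Mc ρ : ℕ} (hρ : L ≤ ρ) (hΩ : i.Ω = cubeFam false L a Mc ρ i.k) (hΛs : i.Λs = cubeLamS L a Mc ρ i.k)
    (hfin : (i.Ω 0).Finite) {m : ℕ} (hm : m ≤ i.k) {U₀ U₀' : Site d → Fin d → 𝔸ˣ}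
    (hside : ∀ (y : Site d) (τ' : Fin d), SideTouches (i.Ω 0) y τ' → U₀ y τ' = U₀' y τ') (J : Site d → Fin d → 𝔸) :
    gopZdH i.η (opsAllZd τ L (cubeLamBP L a Mc ρ i.k) ops₀ M i m) (i.Ω 0) U₀ J =
      gopZdH i.η (opsAllZd τ L (cubeLamBP L a Mc ρ i.k) ops₀ M i m) (i.Ω 0) U₀' J :=
  gopZdH_congr_of_deltaADom i.η _ (i.Ω 0) (fun A _ => deltaADom_congr_of_bonds i.η _ (i.Ω 0) fun _ _ hb =>
    deltaAOf_opsAllZd_congr_cube_sides τ hd2 hL ops₀ M i hρ hΩ hΛs hfin hm hside A hb) J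

end Locality

/-! ## §2 (G): the kernel decay of `G_𝔤` passes along unitary gauge orbits -/

section Gauge

variable (τ : 𝔸 →ₗ[ℂ] ℂ) [FiniteDimensional ℝ 𝔸] [Nontrivial 𝔸] {L : ℕ}

omit [FiniteDimensional ℝ 𝔸] [Nontrivial 𝔸] in
/-- a bump is a rotated bump: `δ_{b′}w = R(u)δ_{b′}(R(u(b′))⁻¹w)`. [cite: Balaban1985BackgroundPropagators, (3.28) p.395 (bookkeeping)] -/
theorem bump_eq_rotB_bump (u : Site d → 𝔸ˣ) (y' : Site d) (μ' : Fin d) (w : 𝔸) :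
    bump y' μ' w = rotB u (bump y' μ' (conjR (u y')⁻¹ w)) := by
  funext x κ
  rw [rotB_apply]
  unfold bump
  split_ifs with h
  · rw [h.1, B7Eq125RightInverse.conjR_conjR_inv]
  · rw [conjR_apply, mul_zero, zero_mul]

/-- ★★ **(G) THE KERNEL DECAY OF `G_𝔤` IS GAUGE INVARIANT**: if `|(G_𝔤(U₀)δ_{b′}w)(b)|_τ ≤ C·e^{−κ|b−b′|_∞}·|w|_τ` for the bonds of `Ω₀` and Hermitian `w`, then the same
holds at `U₀^u` (`u` unitary, `τ` tracial) — by (3.34) `G_𝔤(U₀^u)(R(u)J) = R(u)G_𝔤(U₀)J` (dag-n06-w3's `gopZdH_opsAllZd_gaugeAct`), `δ_{b′}w = R(u)δ_{b′}(R(u(b′))⁻¹w)`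
and `|R(v)a|_τ = |a|_τ`. [cite: Balaban1985BackgroundPropagators, (3.34) p.396, (3.28) p.395, Thm 3.11 p.416] -/
theorem kernelDecay_opsAllZd_gaugeAct (hL : 2 ≤ L) (ΛbP : ℕ → ℕ → Set (Site d × Fin d)) (ops₀ : ℝ → ZdIdx d L → ℕ → OpsZd d 𝔸) (M : ℝ)
    (i : ZdIdx d L) (m : ℕ) (hbox : ∀ j, 1 ≤ j → j ≤ m → ∀ c ∈ ΛbP m j, ∀ x, InBox (loK L j c.1) (bondHiK L j c.1 c.2) x → x ∈ i.Ω (j - 1))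
    (hτt : ∀ a b : 𝔸, τ (a * b) = τ (b * a)) (hτs : ∀ a : 𝔸, τ (star a) = starRingEnd ℂ (τ a)) (hτp : ∀ a : 𝔸, a ≠ 0 → 0 < (τ (star a * a)).re)
    (hΩ : (i.Ω 0).Finite) {C κ : ℝ} {u : Site d → 𝔸ˣ} {U₀ : Site d → Fin d → 𝔸ˣ} (hu : ∀ z, u z ∈ unitaryUnits 𝔸)
    (hU₀ : ∀ x κ', U₀ x κ' ∈ unitaryUnits 𝔸)
    (hP : ∀ b b' : Site d × Fin d, BondTouches (i.Ω 0) b.1 b.2 → BondTouches (i.Ω 0) b'.1 b'.2 → ∀ w : 𝔸, IsSelfAdjoint w →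
      fnorm τ (gopZdH i.η (opsAllZd τ L ΛbP ops₀ M i m) (i.Ω 0) U₀ (bump b'.1 b'.2 w) b.1 b.2) ≤
        C * Real.exp (-(κ * (linfDist b.1 b'.1 : ℝ))) * fnorm τ w) :
    ∀ b b' : Site d × Fin d, BondTouches (i.Ω 0) b.1 b.2 → BondTouches (i.Ω 0) b'.1 b'.2 → ∀ w : 𝔸, IsSelfAdjoint w →
      fnorm τ (gopZdH i.η (opsAllZd τ L ΛbP ops₀ M i m) (i.Ω 0) (gaugeAct u U₀) (bump b'.1 b'.2 w) b.1 b.2) ≤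
        C * Real.exp (-(κ * (linfDist b.1 b'.1 : ℝ))) * fnorm τ w := by
  intro b b' hb hb' w hw
  have hu' : (u b'.1)⁻¹ ∈ unitaryUnits 𝔸 := (unitaryUnits 𝔸).inv_mem (hu b'.1)
  have hw₀ : IsSelfAdjoint (conjR (u b'.1)⁻¹ w) := isSelfAdjoint_conjR hu' hw
  have hcov := gopZdH_opsAllZd_gaugeAct τ L ΛbP ops₀ M i m hL hbox hτt hτs hτp hU₀ hu hΩ (bump b'.1 b'.2 (conjR (u b'.1)⁻¹ w))
  have hrec : gopZdH i.η (opsAllZd τ L ΛbP ops₀ M i m) (i.Ω 0) (gaugeAct u U₀) (bump b'.1 b'.2 w) b.1 b.2 =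
      conjR (u b.1) (gopZdH i.η (opsAllZd τ L ΛbP ops₀ M i m) (i.Ω 0) U₀ (bump b'.1 b'.2 (conjR (u b'.1)⁻¹ w)) b.1 b.2) := by
    rw [bump_eq_rotB_bump u b'.1 b'.2 w]
    show gopZdH i.η (opsLandau τ (withDpZd (withQQP τ L ΛbP ops₀)) M i m) (i.Ω 0) (gaugeAct u U₀) _ b.1 b.2 = _
    rw [hcov, rotB_apply]
    rfl
  rw [hrec, fnorm_conjR_of_unitary τ hτt (hu b.1)]
  have h := hP b b' hb hb' _ hw₀
  rwa [fnorm_conjR_of_unitary τ hτt hu'] at h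

end Gauge

/-! ## §3 The schema: kernel decay on a uniform ball ⟹ kernel decay from the touching plaquettes -/

section Schema

variable (τ : 𝔸 →ₗ[ℂ] ℂ) [FiniteDimensional ℝ 𝔸] [Nontrivial 𝔸] {L : ℕ}

/-- ★★★ **THE DECAY CLAUSE OF THEOREM 3.11 AT A CUBE MEMBER, FROM A UNIFORM BALL TO THE TOUCHING PLAQUETTES.**  At a cube member (`Ω = cubeFam false L a Mc ρ k`,
`Λs = cubeLamS …`, class `cubeLamBP`, `m ≤ k`, `2 ≤ d`, `2 ≤ L ≤ ρ`), faithful Hermitian tracial `τ`: IF the kernel bound `|(G_𝔤(V)δ_{b′}w)(b)|_τ ≤ C·e^{−κ|b−b′|_∞}·|w|_τ`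
(bonds of `□₀`, Hermitian `w`) holds for every unitary `V` uniformly `δ`-close to `1` (the (B) input — dag-n06-w2's Combes–Thomas stations), THEN `∃ α > 0` such that it
holds, with the SAME `(C, κ)`, for EVERY unitary `U₀` whose plaquettes touching `□₀` are `α`-close to `1` — (G) `kernelDecay_opsAllZd_gaugeAct`, (L)
`gopZdH_opsAllZd_congr_cube_sides`, assembled by the layer-gauge schema `of_touching_plaquettes_unitary`.
[cite: Balaban1985BackgroundPropagators, Thm 3.11 p.416 (the gauge step of its proof), (3.27) p.395, (3.34) p.396; Balaban1985RegularSpaces, (1.7) p.77, Lemma 1 p.79, (1.131) p.99] -/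
theorem kernelDecay_of_plaqTouches_cube_of_ball (hτp : ∀ a : 𝔸, a ≠ 0 → 0 < (τ (star a * a)).re) (hτt : ∀ a b : 𝔸, τ (a * b) = τ (b * a))
    (hτs : ∀ a : 𝔸, τ (star a) = starRingEnd ℂ (τ a)) (hd2 : 2 ≤ d) (hL : 2 ≤ L) (ops₀ : ℝ → ZdIdx d L → ℕ → OpsZd d 𝔸) (M : ℝ) (i : ZdIdx d L)
    {a : Site d} {Mc ρ : ℕ} (hρ : L ≤ ρ) (hΩ : i.Ω = cubeFam false L a Mc ρ i.k) (hΛs : i.Λs = cubeLamS L a Mc ρ i.k) {m : ℕ} (hm : m ≤ i.k)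
    {C κ : ℝ}
    (hB : ∃ δ : ℝ, 0 < δ ∧ ∀ V : Site d → Fin d → 𝔸ˣ, (∀ x κ', V x κ' ∈ unitaryUnits 𝔸) → (∀ x κ', ‖((V x κ' : 𝔸ˣ) : 𝔸) - 1‖ < δ) →
      ∀ b b' : Site d × Fin d, BondTouches (i.Ω 0) b.1 b.2 → BondTouches (i.Ω 0) b'.1 b'.2 → ∀ w : 𝔸, IsSelfAdjoint w →
        fnorm τ (gopZdH i.η (opsAllZd τ L (cubeLamBP L a Mc ρ i.k) ops₀ M i m) (i.Ω 0) V (bump b'.1 b'.2 w) b.1 b.2) ≤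
          C * Real.exp (-(κ * (linfDist b.1 b'.1 : ℝ))) * fnorm τ w) :
    ∃ α : ℝ, 0 < α ∧ ∀ U₀ : Site d → Fin d → 𝔸ˣ, (∀ x κ', U₀ x κ' ∈ unitaryUnits 𝔸) →
      (∀ (z : Site d) (κ' μ : Fin d), κ' ≠ μ → PlaqTouches (i.Ω 0) z κ' μ → ‖plaqF U₀ κ' μ z - 1‖ ≤ α) →
        ∀ b b' : Site d × Fin d, BondTouches (i.Ω 0) b.1 b.2 → BondTouches (i.Ω 0) b'.1 b'.2 → ∀ w : 𝔸, IsSelfAdjoint w →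
          fnorm τ (gopZdH i.η (opsAllZd τ L (cubeLamBP L a Mc ρ i.k) ops₀ M i m) (i.Ω 0) U₀ (bump b'.1 b'.2 w) b.1 b.2) ≤
            C * Real.exp (-(κ * (linfDist b.1 b'.1 : ℝ))) * fnorm τ w := by
  haveI : NeZero L := ⟨by omega⟩
  have hL1 : 1 ≤ L := le_trans (by norm_num) hL
  have hfin : (i.Ω 0).Finite := B9Thm311PosDefOpenZd.cubeMember_Ω0_finite i hΩ
  have hset : {y : Site d | InBox (sqLo L a ρ i.k 0) (sqHi L a Mc ρ i.k 0) y} = i.Ω 0 := by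
    rw [hΩ, cubeFam_false_zero]; ext y; exact (B8Ineq159FlatCubeMemberKernel.mem_cube_zero_iff L a Mc ρ i.k y).symm
  have hbox := hbox0_cubeLamBP_of_eq hL1 i a Mc hρ hΩ hm
  -- (G)
  have hcov : ∀ (u : Site d → 𝔸ˣ) (U : Site d → Fin d → 𝔸ˣ), (∀ x, u x ∈ unitaryUnits 𝔸) → (∀ x κ', U x κ' ∈ unitaryUnits 𝔸) →
      (∀ b b' : Site d × Fin d, BondTouches (i.Ω 0) b.1 b.2 → BondTouches (i.Ω 0) b'.1 b'.2 → ∀ w : 𝔸, IsSelfAdjoint w →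
        fnorm τ (gopZdH i.η (opsAllZd τ L (cubeLamBP L a Mc ρ i.k) ops₀ M i m) (i.Ω 0) U (bump b'.1 b'.2 w) b.1 b.2) ≤
          C * Real.exp (-(κ * (linfDist b.1 b'.1 : ℝ))) * fnorm τ w) →
      ∀ b b' : Site d × Fin d, BondTouches (i.Ω 0) b.1 b.2 → BondTouches (i.Ω 0) b'.1 b'.2 → ∀ w : 𝔸, IsSelfAdjoint w →
        fnorm τ (gopZdH i.η (opsAllZd τ L (cubeLamBP L a Mc ρ i.k) ops₀ M i m) (i.Ω 0) (gaugeAct u U) (bump b'.1 b'.2 w) b.1 b.2) ≤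
          C * Real.exp (-(κ * (linfDist b.1 b'.1 : ℝ))) * fnorm τ w :=
    fun u U hu hU hPU => kernelDecay_opsAllZd_gaugeAct τ hL (cubeLamBP L a Mc ρ i.k) ops₀ M i m hbox hτt hτs hτp hfin hu hU hPU
  -- (L)
  have hloc : ∀ (U U' : Site d → Fin d → 𝔸ˣ), (∀ x κ', U x κ' ∈ unitaryUnits 𝔸) → (∀ x κ', U' x κ' ∈ unitaryUnits 𝔸) →
      (∀ (y : Site d) (τ' : Fin d), SideTouches {z | InBox (sqLo L a ρ i.k 0) (sqHi L a Mc ρ i.k 0) z} y τ' → U y τ' = U' y τ') →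
      (∀ b b' : Site d × Fin d, BondTouches (i.Ω 0) b.1 b.2 → BondTouches (i.Ω 0) b'.1 b'.2 → ∀ w : 𝔸, IsSelfAdjoint w →
        fnorm τ (gopZdH i.η (opsAllZd τ L (cubeLamBP L a Mc ρ i.k) ops₀ M i m) (i.Ω 0) U (bump b'.1 b'.2 w) b.1 b.2) ≤
          C * Real.exp (-(κ * (linfDist b.1 b'.1 : ℝ))) * fnorm τ w) →
      ∀ b b' : Site d × Fin d, BondTouches (i.Ω 0) b.1 b.2 → BondTouches (i.Ω 0) b'.1 b'.2 → ∀ w : 𝔸, IsSelfAdjoint w →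
        fnorm τ (gopZdH i.η (opsAllZd τ L (cubeLamBP L a Mc ρ i.k) ops₀ M i m) (i.Ω 0) U' (bump b'.1 b'.2 w) b.1 b.2) ≤
          C * Real.exp (-(κ * (linfDist b.1 b'.1 : ℝ))) * fnorm τ w := by
    intro U U' _ _ hag hPU b b' hb hb' w hw
    rw [hset] at hag
    rw [← gopZdH_opsAllZd_congr_cube_sides τ hd2 hL ops₀ M i hρ hΩ hΛs hfin hm hag]
    exact hPU b b' hb hb' w hw
  obtain ⟨α, hα, hmain⟩ := of_touching_plaquettes_unitary (sqLo_le_sqHi_zero L a Mc (le_trans hL1 hρ) i.k) hB hcov hloc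
  exact ⟨α, hα, fun U₀ hU₀ hsmall => hmain U₀ hU₀ fun z κ' μ hκμ hpt => hsmall z κ' μ hκμ (by rw [hset] at hpt; exact hpt)⟩

/-- ★★ **THE DATUM'S CURRENCY**: under the same (B) input, `∃ α > 0` such that for every `α₀ ≤ α` and every unitary `U₀ ∈ 𝔄_m({□_j}, α₀)` (`InAk L m i.η α₀ i.Ω U₀`,
the level-`0` clause of [Balaban1985RegularSpaces] (1.7)) the kernel bound holds with `(C, κ)`. [cite: Balaban1985BackgroundPropagators, Thm 3.11 p.416; Balaban1985RegularSpaces, (1.7) p.77, (1.33) p.82, (1.131) p.99] -/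
theorem kernelDecay_of_inAk_cube_of_ball (hτp : ∀ a : 𝔸, a ≠ 0 → 0 < (τ (star a * a)).re) (hτt : ∀ a b : 𝔸, τ (a * b) = τ (b * a))
    (hτs : ∀ a : 𝔸, τ (star a) = starRingEnd ℂ (τ a)) (hd2 : 2 ≤ d) (hL : 2 ≤ L) (ops₀ : ℝ → ZdIdx d L → ℕ → OpsZd d 𝔸) (M : ℝ) (i : ZdIdx d L)
    {a : Site d} {Mc ρ : ℕ} (hρ : L ≤ ρ) (hΩ : i.Ω = cubeFam false L a Mc ρ i.k) (hΛs : i.Λs = cubeLamS L a Mc ρ i.k) {m : ℕ} (hm : m ≤ i.k)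
    {C κ : ℝ}
    (hB : ∃ δ : ℝ, 0 < δ ∧ ∀ V : Site d → Fin d → 𝔸ˣ, (∀ x κ', V x κ' ∈ unitaryUnits 𝔸) → (∀ x κ', ‖((V x κ' : 𝔸ˣ) : 𝔸) - 1‖ < δ) →
      ∀ b b' : Site d × Fin d, BondTouches (i.Ω 0) b.1 b.2 → BondTouches (i.Ω 0) b'.1 b'.2 → ∀ w : 𝔸, IsSelfAdjoint w →
        fnorm τ (gopZdH i.η (opsAllZd τ L (cubeLamBP L a Mc ρ i.k) ops₀ M i m) (i.Ω 0) V (bump b'.1 b'.2 w) b.1 b.2) ≤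
          C * Real.exp (-(κ * (linfDist b.1 b'.1 : ℝ))) * fnorm τ w) :
    ∃ α : ℝ, 0 < α ∧ ∀ α₀ : ℝ, α₀ ≤ α → ∀ U₀ : Site d → Fin d → 𝔸ˣ, (∀ x κ', U₀ x κ' ∈ unitaryUnits 𝔸) → InAk L m i.η α₀ i.Ω U₀ →
      ∀ b b' : Site d × Fin d, BondTouches (i.Ω 0) b.1 b.2 → BondTouches (i.Ω 0) b'.1 b'.2 → ∀ w : 𝔸, IsSelfAdjoint w →
        fnorm τ (gopZdH i.η (opsAllZd τ L (cubeLamBP L a Mc ρ i.k) ops₀ M i m) (i.Ω 0) U₀ (bump b'.1 b'.2 w) b.1 b.2) ≤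
          C * Real.exp (-(κ * (linfDist b.1 b'.1 : ℝ))) * fnorm τ w := by
  obtain ⟨α, hα, h⟩ := kernelDecay_of_plaqTouches_cube_of_ball τ hτp hτt hτs hd2 hL ops₀ M i hρ hΩ hΛs hm hB
  exact ⟨α, hα, fun α₀ hα₀ U₀ hU₀ hA => h U₀ hU₀ fun z κ' μ hκμ hpt => (plaq_le_of_inAk hA z κ' μ hκμ hpt).trans hα₀⟩

end Schema

/-! ## §4 The (B) input made unconditional: dag-n06-w2's global-class theorem with the three local-letter bounds discharged -/

section Global

variable (τ : 𝔸 →ₗ[ℂ] ℂ) [FiniteDimensional ℝ 𝔸] [Nontrivial 𝔸] {L : ℕ}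

/-- ★★★ **THE KERNEL OF `G_𝔤(U₀)` DECAYS AT EVERY CUBE MEMBER FOR EVERY UNITARY BACKGROUND OF THE CLOSED GLOBAL SMALL-FIELD CLASS — NO DISPLAYED HYPOTHESIS**:
dag-n06-w2's `exists_fnorm_gopZdH_bump_le_exp_cubeMember_of_letters` (Combes–Thomas stations 1–5 + dag-n06-w4's coercivity + this seat's per-member regularity) with
its three local-letter inputs `hLet` supplied by `exists_letterBounds_opsAllZd_cube` (radii `2Lᵐ`) and `hCτ` by `exists_Ctau`.  `2 ≤ d`, `2 ≤ L ≤ ρ`, `m ≤ k`,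
`i.Ω = cubeFam false L a₀ Mc ρ k`, `i.Λs = cubeLamS …`, weights `a ≥ 0`, faithful Hermitian tracial `τ`.
[cite: Balaban1985BackgroundPropagators, Thm 3.3 p.399, Thm 3.11 p.416, (3.26)–(3.27) p.395; Balaban1985RegularSpaces, (1.131) p.99, (1.7) p.77; Balaban1984PropagatorsII, p.226] -/
theorem exists_kernelDecay_cubeMember (hτp : ∀ a : 𝔸, a ≠ 0 → 0 < (τ (star a * a)).re) (hτt : ∀ a b : 𝔸, τ (a * b) = τ (b * a))
    (hτs : ∀ a : 𝔸, τ (star a) = starRingEnd ℂ (τ a)) (hd2 : 2 ≤ d) (hL : 2 ≤ L) (ops₀ : ℝ → ZdIdx d L → ℕ → OpsZd d 𝔸) (M : ℝ) (i : ZdIdx d L)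
    {a₀ : Site d} {Mc ρ : ℕ} (hρ : L ≤ ρ) (hΩ : i.Ω = cubeFam false L a₀ Mc ρ i.k) (hΛs : i.Λs = cubeLamS L a₀ Mc ρ i.k) {m : ℕ} (hm : m ≤ i.k)
    (a : ℕ → ℝ) (ha : ∀ j, 0 ≤ a j) :
    ∃ β₀ : ℝ, 0 < β₀ ∧ ∀ β : ℝ, 0 ≤ β → β < β₀ → ∃ C : ℝ, 0 < C ∧ ∃ κ : ℝ, 0 < κ ∧
      ∀ (U₀ : Site d → Fin d → 𝔸ˣ), (∀ x κ', U₀ x κ' ∈ unitaryUnits 𝔸) → (∀ (x : Site d) (μ ν : Fin d), ‖plaqF U₀ μ ν x - 1‖ ≤ β) →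
        ∀ b b' : Site d × Fin d, BondTouches (i.Ω 0) b.1 b.2 → BondTouches (i.Ω 0) b'.1 b'.2 → ∀ w : 𝔸, IsSelfAdjoint w →
          fnorm τ (gopZdH i.η (opsAllZd τ L (cubeLamBP L a₀ Mc ρ i.k) ops₀ M i m) (i.Ω 0) U₀ (bump b'.1 b'.2 w) b.1 b.2) ≤
            C * Real.exp (-(κ * (linfDist b.1 b'.1 : ℝ))) * fnorm τ w := by
  obtain ⟨Cτ, -, hCτ⟩ := exists_Ctau τ
  obtain ⟨BJ, BDp, BQ, hBJ, hBDp, hBQ, hLet⟩ := exists_letterBounds_opsAllZd_cube τ L ops₀ M i m hτp hL hCτ a₀ Mc hρ hΩ hm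
  exact exists_fnorm_gopZdH_bump_le_exp_cubeMember_of_letters τ hτp hτt hτs L hd2 hL ops₀ M i hρ hΩ hΛs hm a ha hBJ hBDp hBQ _ _ _ hLet

end Global

/-! ## §5 ★★★★ The decay clause of Theorem 3.11 at the member in the touching ∕ datum currency, no displayed hypothesis -/

section Touching

variable (τ : 𝔸 →ₗ[ℂ] ℂ) [FiniteDimensional ℝ 𝔸] [Nontrivial 𝔸] {L : ℕ}

/-- ★★★★ **[B9] THEOREM 3.11's DECAY CLAUSE AT ONE CUBE MEMBER FROM THE LEVEL-0 CLAUSE OF (1.7)**: at a cube member (`Ω = cubeFam false L a₀ Mc ρ k`, `Λs = cubeLamS …`,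
class `cubeLamBP`, `m ≤ k`, `2 ≤ d`, `2 ≤ L ≤ ρ`), weights `a ≥ 0`, faithful Hermitian tracial `τ` on a finite-dimensional fibre: THERE ARE `α, C, κ > 0` (depending on the
member) such that EVERY unitary background `U₀` with `‖U₀(∂p) − 1‖ ≤ α` for the plaquettes `p` TOUCHING `□₀` has
`|(G_𝔤(U₀)δ_{b′}w)(b)|_τ ≤ C·e^{−κ|b−b′|_∞}·|w|_τ` for all bonds `b, b′` of `□₀` and Hermitian `w`, `G_𝔤(U₀) = (□₀Δ_a(U₀)□₀)⁻¹` over the genuine four-letter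
`Δ_a(U₀) = D*D + Δ′(U₀) + D R(U₀) 𝟙 D* + Q*aQ(U₀)`.  PROOF: §4 on the uniform ball `‖U₀(b) − 1‖ < β∕4` (B), §2 (G), §1 (L), the layer-gauge schema.
[cite: Balaban1985BackgroundPropagators, Thm 3.11 p.416, Thm 3.3 p.399, (3.27) p.395, (3.34) p.396; Balaban1985RegularSpaces, (1.7) p.77, Lemma 1 p.79, (1.131) p.99] -/
theorem exists_kernelDecay_of_plaqTouches_cube (hτp : ∀ a : 𝔸, a ≠ 0 → 0 < (τ (star a * a)).re) (hτt : ∀ a b : 𝔸, τ (a * b) = τ (b * a))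
    (hτs : ∀ a : 𝔸, τ (star a) = starRingEnd ℂ (τ a)) (hd2 : 2 ≤ d) (hL : 2 ≤ L) (ops₀ : ℝ → ZdIdx d L → ℕ → OpsZd d 𝔸) (M : ℝ) (i : ZdIdx d L)
    {a₀ : Site d} {Mc ρ : ℕ} (hρ : L ≤ ρ) (hΩ : i.Ω = cubeFam false L a₀ Mc ρ i.k) (hΛs : i.Λs = cubeLamS L a₀ Mc ρ i.k) {m : ℕ} (hm : m ≤ i.k)
    (a : ℕ → ℝ) (ha : ∀ j, 0 ≤ a j) :
    ∃ α : ℝ, 0 < α ∧ ∃ C : ℝ, 0 < C ∧ ∃ κ : ℝ, 0 < κ ∧ ∀ U₀ : Site d → Fin d → 𝔸ˣ, (∀ x κ', U₀ x κ' ∈ unitaryUnits 𝔸) →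
      (∀ (z : Site d) (κ' μ : Fin d), κ' ≠ μ → PlaqTouches (i.Ω 0) z κ' μ → ‖plaqF U₀ κ' μ z - 1‖ ≤ α) →
        ∀ b b' : Site d × Fin d, BondTouches (i.Ω 0) b.1 b.2 → BondTouches (i.Ω 0) b'.1 b'.2 → ∀ w : 𝔸, IsSelfAdjoint w →
          fnorm τ (gopZdH i.η (opsAllZd τ L (cubeLamBP L a₀ Mc ρ i.k) ops₀ M i m) (i.Ω 0) U₀ (bump b'.1 b'.2 w) b.1 b.2) ≤
            C * Real.exp (-(κ * (linfDist b.1 b'.1 : ℝ))) * fnorm τ w := by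
  obtain ⟨β₀, hβ₀, hglob⟩ := exists_kernelDecay_cubeMember τ hτp hτt hτs hd2 hL ops₀ M i hρ hΩ hΛs hm a ha
  obtain ⟨C, hC, κ, hκ, hdec⟩ := hglob (β₀ / 2) (by positivity) (by linarith)
  -- (B): the uniform ball `‖V(b) − 1‖ < β₀∕8` lies in the closed global class `β₀∕2` (`‖V(∂p) − 1‖ ≤ 4·(β₀∕8)`)
  have hB : ∃ δ : ℝ, 0 < δ ∧ ∀ V : Site d → Fin d → 𝔸ˣ, (∀ x κ', V x κ' ∈ unitaryUnits 𝔸) → (∀ x κ', ‖((V x κ' : 𝔸ˣ) : 𝔸) - 1‖ < δ) →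
      ∀ b b' : Site d × Fin d, BondTouches (i.Ω 0) b.1 b.2 → BondTouches (i.Ω 0) b'.1 b'.2 → ∀ w : 𝔸, IsSelfAdjoint w →
        fnorm τ (gopZdH i.η (opsAllZd τ L (cubeLamBP L a₀ Mc ρ i.k) ops₀ M i m) (i.Ω 0) V (bump b'.1 b'.2 w) b.1 b.2) ≤
          C * Real.exp (-(κ * (linfDist b.1 b'.1 : ℝ))) * fnorm τ w := by
    refine ⟨β₀ / 8, by positivity, fun V hV hclose => hdec V hV fun x μ ν => ?_⟩
    have hV1 : ∀ x κ', V x κ' ∈ U1 𝔸 := fun x κ' => unitaryUnits_le_U1 (hV x κ')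
    have h := norm_plaqF_sub_one_le hV1 (fun x κ' => (hclose x κ').le) μ ν x
    linarith
  obtain ⟨α, hα, h⟩ := kernelDecay_of_plaqTouches_cube_of_ball τ hτp hτt hτs hd2 hL ops₀ M i hρ hΩ hΛs hm hB
  exact ⟨α, hα, C, hC, κ, hκ, h⟩

/-- ★★★★ **THE SAME FOR EVERY DATUM OF THE JUNCTION**: `∃ α C κ > 0` such that for every `α₀ ≤ α` and every unitary `U₀ ∈ 𝔄_m({□_j}, α₀)`
(`B8Ineq132.InAk L m i.η α₀ i.Ω U₀` — the socket's own hypothesis [Balaban1985RegularSpaces] (1.33)) the kernel of `G_𝔤(U₀)` decays with `(C, κ)` on the bonds of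
`□₀` — the decay half of what the junction's `GlobAtI`∕(3.47) suppliers want from [B9] Thm 3.3 at the member, in the currency they are keyed in.
[cite: Balaban1985BackgroundPropagators, Thm 3.11 p.416, Thm 3.3 p.399; Balaban1985RegularSpaces, (1.7) p.77, (1.33) p.82, (1.58)–(1.59) p.86, (1.131) p.99] -/
theorem exists_kernelDecay_of_inAk_cube (hτp : ∀ a : 𝔸, a ≠ 0 → 0 < (τ (star a * a)).re) (hτt : ∀ a b : 𝔸, τ (a * b) = τ (b * a))
    (hτs : ∀ a : 𝔸, τ (star a) = starRingEnd ℂ (τ a)) (hd2 : 2 ≤ d) (hL : 2 ≤ L) (ops₀ : ℝ → ZdIdx d L → ℕ → OpsZd d 𝔸) (M : ℝ) (i : ZdIdx d L)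
    {a₀ : Site d} {Mc ρ : ℕ} (hρ : L ≤ ρ) (hΩ : i.Ω = cubeFam false L a₀ Mc ρ i.k) (hΛs : i.Λs = cubeLamS L a₀ Mc ρ i.k) {m : ℕ} (hm : m ≤ i.k)
    (a : ℕ → ℝ) (ha : ∀ j, 0 ≤ a j) :
    ∃ α : ℝ, 0 < α ∧ ∃ C : ℝ, 0 < C ∧ ∃ κ : ℝ, 0 < κ ∧ ∀ α₀ : ℝ, α₀ ≤ α → ∀ U₀ : Site d → Fin d → 𝔸ˣ, (∀ x κ', U₀ x κ' ∈ unitaryUnits 𝔸) →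
      InAk L m i.η α₀ i.Ω U₀ →
        ∀ b b' : Site d × Fin d, BondTouches (i.Ω 0) b.1 b.2 → BondTouches (i.Ω 0) b'.1 b'.2 → ∀ w : 𝔸, IsSelfAdjoint w →
          fnorm τ (gopZdH i.η (opsAllZd τ L (cubeLamBP L a₀ Mc ρ i.k) ops₀ M i m) (i.Ω 0) U₀ (bump b'.1 b'.2 w) b.1 b.2) ≤
            C * Real.exp (-(κ * (linfDist b.1 b'.1 : ℝ))) * fnorm τ w := by
  obtain ⟨α, hα, C, hC, κ, hκ, h⟩ := exists_kernelDecay_of_plaqTouches_cube τ hτp hτt hτs hd2 hL ops₀ M i hρ hΩ hΛs hm a ha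
  exact ⟨α, hα, C, hC, κ, hκ, fun α₀ hα₀ U₀ hU₀ hA =>
    h U₀ hU₀ fun z κ' μ hκμ hpt => (plaq_le_of_inAk hA z κ' μ hκμ hpt).trans hα₀⟩

end Touching

end Literature.MathematicalPhysics.QuantumFieldTheory.Balaban1983to89.B9Thm311KernelDecayTouchingCubeZd

end
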